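import Mathlib
import HarnessLib
import HarnessLib.Audit
import Summits.ValiantsHypothesis.Statement
import Summits.ValiantsHypothesis.ValiantsHypothesis.Theorems.TowerDoorS5Conjecture
import HarnessLib.Audit.Status.Attr

/-!
Route: TowerDoorS5

# Route TowerDoorS5 — DOOR — the tower graft law S5 alone implies VP ≠ VNP (sufficient, not
equivalent; not a decomposition)

DOOR · single open research statement S5 · sufficient not equivalent · NOT a decomposition ·
contributes 0 to summit-progress accounting until S5 moves. It suffices to show S5 = THE TOWER GRAFT
LAW `TowerGraftLaw` (GL): there is an absolute C such that on every m-TOWER support d (each exponent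
exceeds m times every earlier one) grafting ONE far letter X^D (D > m·max d) onto a real symmetric
lacunary pencil costs at most a factor 2^C and an additive 2^{C ⌊log₂ m⌋²} in the number ζ₊ of
distinct positive real zeros of the determinant: `PosRootLawOn m K B d → PosRootLawOn m (K+1) (2^C·B
+ 2^{C log₂² m}) (d ⊔ D)`. S5 iterated along the tower is TOWER-B (Conjecture B of pub-symmetroid on
tower supports, budget 2^{(C+1)(K + log₂² m)}), and TOWER-B ALONE implies VP ≠ VNP by the tree
theorem `LacunarySymmetroid.TowerDoor.valiant_of_towerB_alone` (p672005: PencilTransfer and the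
tower ThetaWitness are discharged in Theorems). The route is opened on ORDER (director-valiant g17
R313 (1), 2026-08-28T22:53Z) executing the coordinator's ruling «21-frontier b141, HOME/INBOX
l.16908: YES, keep ONE: TowerDoorS5» (D-0146 sufficient route); BC1 1-open-binder is KEPT by that
ruling; the gate's crux floor (D-0019: a one-crux thesis opens only as an explicit CONDITIONAL
BRIDGE) is met by filing the door as what it is — conditional_bridge on its own single crux
`TowerGraftLaw` (VP ≠ VNP ⟸ S5, S5 OPEN and served as the route's rank-2 item). Routes
LacunarySymmetroid (rev 7) and KPlusLogSqLaw (rev 16) are untouched; S5 is the registered stub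
`stub_oneLetterGraftLaw` of LINE (B) `Cruxes/WeakLifting/Lines/tower_graft.lean` rev 11 and the
route's crux decl is that statement verbatim (definitionally equal, `Iff.rfl` checked), so one proof
closes both.
Lean: `Summit.ValiantsHypothesis.ValiantsHypothesis.Theorems.TowerDoorS5.TowerGraftLaw` (the route's
crux decl `Theses.TowerDoorS5.TowerGraftLaw` is this NAMED tree statement; = `∃ C : ℕ, ∀ (m K B D :
ℕ) (d : Fin K → ℕ), (∀ l l' : Fin K, l < l' → m * d l < d l') → (∀ l, m * d l < D) →
LacunarySymmetroidMatrixDescartes.PosRootLawOn m K B d →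
LacunarySymmetroidMatrixDescartes.PosRootLawOn m (K + 1) (2 ^ C * B + 2 ^ (C * Nat.log 2 m ^ 2))
(Fin.snoc d D)`)

## Assembly
Pure logic, certified in glue.lean: `closes (h : TowerGraftLaw) : _root_.ValiantsHypothesis :=
Theorems.TowerDoorS5.valiant_of_towerGraftLaw h` — ONE binder, S5, exactly as ordered (R313 (1) /
R317 (1): «closes (h : TowerGraftLaw) : ValiantsHypothesis by valiant_of_towerB_alone ∘
towerB_of_graftLaw», both joints theorems in `Theorems/TowerDoorS5Conjecture.lean` and
`Theorems/LacunarySymmetroidTowerDoor.lean` p672005). The route is a declared CONDITIONAL BRIDGE on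
the named statement `Theorems.TowerDoorS5.TowerGraftLaw` (= its own rank-2 crux, by name), which is
how the D-0019 crux floor admits a one-crux door.

CONDITIONAL on Summit.ValiantsHypothesis.ValiantsHypothesis.Theorems.TowerDoorS5.TowerGraftLaw — this route is an explicit reduction to that named conjecture (D-0019: crux floor waived).

Rationale: WHY THIS LINE. Mechanism: the tower door of the object-search cell pub-symmetroid (Conjecture B
programme, human ruling D-0041) — on m-tower supports the determinant of a grafted pencil `det(G +
X^D S)` is the base-X^D digit string of the bivariate pencil determinant `det(G + T·S)` (digit
expansion, landed `KPlusLogSqLaw.TowerGraft.tower_digitExpansion`), so positive zeros of the graft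
are controlled letter by letter; S5 asserts the one-letter cost is a constant factor plus a
quasi-polynomial additive term, which is exactly what the induction `B_{K+1} = 2^C B_K + 2^{C L²}`
needs to reach the tower budget 2^{(C+1)(K+L²)}. Imported area: real fewnomial / Descartes-type root
counting for structured exponential sums (Khovanskii1991, BihanSottile2007) and the real
τ-conjecture circle (Koiran2011, KoiranPortierTavenas2015, KoiranPortierTavenasThomasse2015) —
transplanted from sums of products of sparse polynomials to determinants of symmetric lacunary
pencils, where the summit glue (PencilTransfer + ThetaWitness, both theorems) converts a tower
real-root law into VP ≠ VNP. What this route does that LacunarySymmetroid / KPlusLogSqLaw do not: it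
isolates the ONE research statement the tower glue actually consumes (S5), with every other leg a
theorem, so that the ledger shows the door honestly as «sufficient, 0 progress until S5 moves»
instead of hiding it inside the 3-binder MatrixDescartes route or the TropicalB ∧ WeakLifting split;
it is NOT a decomposition of either.

RANKED CRUXES. #2 TowerGraftLaw (crux) — S5, the tower graft law (GL): an absolute C such that for
every m-tower d : Fin K → ℕ, every far exponent D > m·max d and every budget B, `PosRootLawOn m K B
d` implies `PosRootLawOn m (K+1) (2^C·B + 2^{C·⌊log₂ m⌋²}) (Fin.snoc d D)` (LINE (B)
`tower_graft.lean` S5 `stub_oneLetterGraftLaw`, crux idea `Cruxes/WeakLifting/Ideas/tower-graft.md`,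
door idea `Cruxes/MatrixDescartes/Ideas/tower-door.md`). [difficulty: open-problem] (why it might
fail: S5 is uniform in the budget B and in the far letter S of any signature; an indefinite far
letter can create ≍ m·B new positive zeros per graft (branch arcs T = −1/μ_i(t) need not be
monotone), breaking the constant factor 2^C — only the PSD/PD, rank-one and corner rungs are
theorems.) [Khovanskii1991, BihanSottile2007, Koiran2011, KoiranPortierTavenas2015,
KoiranPortierTavenasThomasse2015,
tree:Summit.ValiantsHypothesis.ValiantsHypothesis.Theorems.LacunarySymmetroid.TowerDoor.valiant_of_towerB_alone,
tree:Summit.ValiantsHypothesis.ValiantsHypothesis.Theorems.KPlusLogSqLaw.TowerGraft.tower_digitExpansion]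
#9 TowerBOfGraftLaw (support) — (GL) iterated along the tower gives TOWER-B with constant C+1
(induction on K; B_{K+1} = 2^C·B_K + 2^{C L²}, B_0 = anything since a 0-letter pencil has no
positive zeros) — the hypothesis of `valiant_of_towerB_alone` verbatim; PROVED IN THE TREE as
`Theorems.TowerDoorS5.towerB_of_towerGraftLaw` (file `Theorems/TowerDoorS5Conjecture.lean`, port of
`TowerGraftLine.towerB_of_graftLaw`); the item closes by the one-line landing `theorem
towerBOfGraftLaw_holds : Theses.TowerDoorS5.TowerBOfGraftLaw := fun h =>
Theorems.TowerDoorS5.towerB_of_towerGraftLaw h` (any prover; filed so the ledger records the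
iteration joint by name — it is not a binder of `closes`). [difficulty: provable-now]
[tree:Summit.ValiantsHypothesis.ValiantsHypothesis.Theorems.TowerDoorS5.towerB_of_towerGraftLaw,
tree:Summit.ValiantsHypothesis.ValiantsHypothesis.Theorems.LacunarySymmetroid.TowerDoor.valiant_of_towerB_alone]

TWO-LAYER PLAN. None filed. LINE (B) `Cruxes/WeakLifting/Lines/tower_graft.lean` rev 11
@e1b52cc93eea (val-idea-24 lineage; crit-6 RE-PIN B11) already carries S5's rung ladder as
registered stubs on crux 19561 — S4 `TowerGraftLawId` (identity far letter), S4b corner / rank-one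
(`TowerGraftLawCorner → TowerGraftLawRankOne`, landed `…TowerGraftCornerReduction`,
`…TowerGraftRankOneGraft`), S4d, S4f size-doubling spine (ALTERNATIVE to S5, R301: S4f alone also
gives TowerB via closed S4g/S4h), S5ᴸ `TowerGraftLawPolylog` (weaker polylog currency) — a split of
S5 here would duplicate that skeleton; if S5 closes in pieces there, the pieces are attached to this
item by provers with `--supports`, never as a third layer.

KILL CRITERIA. A real symmetric tower pencil family with ζ₊(m; d ⊔ D) > 2^C ζ₊-budget + 2^{C log₂²
m} for every C (e.g. an indefinite far letter producing ≍ m·B fresh positive zeros per graft at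
bounded K) refutes TowerGraftLaw: close `refuted:TowerGraftLaw`; the door then survives only in the
S4f (size-doubling) spine of LINE (B), which is NOT this route (R313 (3): no TowerDoorS4f route
unless shown inequivalent to S5 and independently testable). ¬TowerB (a tower family beating
2^{C(K+log² m)} for all C — the staircase family lives on towers with log ζ ≈ (K/6) log m, inside
budget) kills S5 and the door together. KPlusLogSqLaw (Conjecture B) or MatrixDescartes proved
elsewhere moots the route (TowerB is their restriction).

NOT DECOMPOSED YET. Everything below S5: the semidefinite / identity / rank-one / corner rungs and
the polylog currency S5ᴸ live as stubs of LINE (B) on crux 19561 and as landed Theorems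
(`KPlusLogSqLawWeakLiftingTowerGraft*`); the val-V1-extremal numerical falsification of S5 at
reachable (m,K,d) is R313 (2)(b)'s pre-registration question, not an item; whether S5 is STRICTLY
stronger than what VP ≠ VNP needs is R313 (2)(a)'s question to crit-6 g2 (answer pending at filing).

CHEAPEST FALSIFIER. Census replay at the smallest tower formats: m = 2, K = 2 → 3 with d = (0, 3,
9·D') and an INDEFINITE far letter S — count positive zeros of det(S₀ + t³S₁ + t^D S) against
2^C·ζ₊(2;2 letters) + 2^{C·1} for small C using the cell's certified root counter (pub-symmetroid
GRID v0.6b tooling); K = 3 towers are Descartes-sharp C(m+2,2) − 1 while ζ₊(m; 2 letters) = m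
(Disproof §D items 2/7), so the additive term is forced and the first informative instance is
whether the FACTOR stays bounded as B grows at K = 4, m = 2..4. Not run by this seat (tenure, kit
0); it is R313 (2)(b)'s pre-registration for val-v1x-lead g1.

NUMBERS. Tower budget of record: TowerB = ζ₊ ≤ 2^{C (K + ⌊log₂ m⌋²)} on m-towers; S5 one-letter cost
2^C·B + 2^{C ⌊log₂ m⌋²}; K = 3 towers Descartes-sharp: ζ₊ = C(m+2,2) − 1; two letters: ζ₊ = m;
staircase family: log ζ ≈ (K/6)·log m at K ≲ log m (inside budget). Items at open: 3 (1 crux, 1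
support already a theorem by name, 1 assembly); binders of `closes`: 1 (S5).

DEFINITION REQUESTS. None: `Theorems.TowerDoorS5.TowerGraftLaw` / `towerB_of_towerGraftLaw` /
`valiant_of_towerGraftLaw` (file `Theorems/TowerDoorS5Conjecture.lean`, landed for this route per
R317), `LacunarySymmetroidMatrixDescartes.PosRootLawOn` (CensusDefs) and
`LacunarySymmetroid.TowerDoor.valiant_of_towerB_alone` (p672005) exist; the tower predicate is
spelled inline.

Novelty: Searches (2026-08-28): tree `rg TowerGraftLaw|towerB_of_graftLaw` over Theses/Theorems/Cruxes (hits: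
LINE (B) tower_graft.lean rev 11, Cruxes/MatrixDescartes/TowerDoor*.lean,
Theorems/LacunarySymmetroidTowerDoor.lean p672005, 8 landed `KPlusLogSqLawWeakLiftingTowerGraft*`
rung files; NO Theses route with S5 as an item); `ledger bib get` Khovanskii1991 / BihanSottile2007
/ Koiran2011 / KoiranPortierTavenas2015 / KoiranPortierTavenasThomasse2015 (held keys of the sibling
routes' literature); the sibling routes' own novelty records (LacunarySymmetroid rev 7,
KPlusLogSqLaw rev 16) searched corpus + galaxy for «lacunary pencil real roots», «symmetric
determinantal fewnomial» with no theorem of shape S5 or TowerB in print.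
Nearest prior art found: KoiranPortierTavenasThomasse2015 (τ-conjecture for Newton polygons:
real-zero bounds for sums of products of sparse polynomials ⇒ VP ≠ VNP-type lower bounds) and
Koiran2011 (real τ-conjecture ⇒ permanent lower bounds) — the same «real root bound ⇒ Valiant
separation» transfer, for depth-4 sums of products, not for determinants of symmetric lacunary
pencils; in-tree nearest: route LacunarySymmetroid (MatrixDescartes at fat formats) and
KPlusLogSqLaw (TropicalB ∧ WeakLifting), of which TowerB is a restriction.
Delta: the door isolates a single one-letter graft inequality on tower supports whose iteration the
tree already converts into VP ≠ VNP — a sufficient statement strictly inside Conjecture B's tower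
restriction, filed so the ledger car  [refs: Khovanskii1991, BihanSottile2007, Koiran2011, KoiranPortierTavenas2015, KoiranPortierTavenasThomasse2015]

Barriers (technique_class: real-root-counting, lacunary-pencils, tower-door): - technique_class: real-root-counting, lacunary-pencils, tower-door
- Literature.Barriers.ValiantsHypothesis.TauRealZeros: outside the class for the same reason as
LacunarySymmetroid — `RealZeroTauBound c` measures τ of GENERAL fan-in-two programs closed under p ↦
2p² − 1 (Chebyshev towers), while S5/TowerB measure the lacunary-pencil FORMAT (m, K) on tower
supports, where the Chebyshev tower costs K = 2^r + 1 letters or size m ≥ 2^{r−1}; honest bet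
inherited: real-root explosions need squaring of intermediate results, which symmetric pencils of
fixed format cannot do.
- Literature.Barriers.ValiantsHypothesis.AlgebraicNaturalProofs: not in the class — an archimedean,
semialgebraic, degree-unbounded bound on positive zeros of restrictions to monomial curves with
tower exponents is not a poly(N)-size polynomial vanishing on coefficient vectors of VP_N; the
barrier is conditional and nothing is claimed either way.
- Literature.Barriers.ValiantsHypothesis.PermanentCharTwo: consistent — S5 uses the ORDER of ℝ and
the summit glue is over ℂ (char 0); nothing characteristic-free is asserted.
- Negatives index: steers around `MatrixDescartes.Negative.MatrixDescartesFalseOfTropicalMonster`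
(tropical monsters at thin formats: S5 lives on TOWER supports with the log² m additive term that
the K = 3 Descartes-sharp towers force) and the refuted `NotB`/`ClosedWindowLaw`-type asides of
KPlusLogSqLaw (not used); no refuted statement of the summit is equal or trivially equivalent to S5
(LINE (

sub-problem: ValiantsHypothesis · status: draft · opened planner-tenure-valiant-dormant-sweep-g14-0 2026-08-28T23:22:34Z · rev 1 · ledger route-ValiantsHypothesis-TowerDoorS5
GENERATED by the gate from the ledger (D-0016/17). Provers cite these decls: `theorem foo : Summit.ValiantsHypothesis.ValiantsHypothesis.Theses.TowerDoorS5.<Decl> := …` in Summits/ValiantsHypothesis/ValiantsHypothesis/Theorems/<Name>.lean.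
-/

namespace Summit.ValiantsHypothesis.ValiantsHypothesis.Theses.TowerDoorS5

open scoped BigOperators Topology Manifold Classical MeasureTheory ProbabilityTheory Matrix InnerProductSpace ComplexConjugate ContinuousMap
open Filter Set Function TopologicalSpace MeasureTheory

attribute [summit_statement] _root_.ValiantsHypothesis

open Literature.PNP

/-- item stmt-ValiantsHypothesis-23803 · crux · rank 2 · open · by planner
why it might fail: S5 is uniform in the budget B and in the far letter S of any signature; an indefinite far letter can create ≍ m·B new positive zeros per graft (branch arcs T = −1/μ_i(t) need not be monotone), breaking the constant factor 2^C — only the PSD/PD, rank-one and corner rungs are theorems.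
sources: Khovanskii1991, BihanSottile2007, Koiran2011, KoiranPortierTavenas2015, KoiranPortierTavenasThomasse2015, tree:Summit.ValiantsHypothesis.ValiantsHypothesis.Theorems.LacunarySymmetroid.TowerDoor.valiant_of_towerB_alone
[crux] S5, the tower graft law (GL): an absolute C such that for every m-tower d : Fin K → ℕ, every
far exponent D > m·max d and every budget B, `PosRootLawOn m K B d` implies `PosRootLawOn m (K+1)
(2^C·B + 2^{C·⌊log₂ m⌋²}) (Fin.snoc d D)` (LINE (B) `tower_graft.lean` S5 `stub_oneLetterGraftLaw`,
crux idea `Cruxes/WeakLifting/Ideas/tower-graft.md`, door idea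
`Cruxes/MatrixDescartes/Ideas/tower-door.md`). [difficulty: open-problem] -/
@[route_item "route-ValiantsHypothesis-TowerDoorS5", crux]
def TowerGraftLaw : Prop :=
  Summit.ValiantsHypothesis.ValiantsHypothesis.Theorems.TowerDoorS5.TowerGraftLaw

/-- item stmt-ValiantsHypothesis-23804 · aside · rank 9 · open · by planner
sources: tree:Summit.ValiantsHypothesis.ValiantsHypothesis.Theorems.TowerDoorS5.towerB_of_towerGraftLaw, tree:Summit.ValiantsHypothesis.ValiantsHypothesis.Theorems.LacunarySymmetroid.TowerDoor.valiant_of_towerB_alone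
[support] (GL) iterated along the tower gives TOWER-B with constant C+1 (induction on K; B_{K+1} =
2^C·B_K + 2^{C L²}, B_0 = anything since a 0-letter pencil has no positive zeros) — the hypothesis
of `valiant_of_towerB_alone` verbatim; PROVED IN THE TREE as
`Theorems.TowerDoorS5.towerB_of_towerGraftLaw` (file `Theorems/TowerDoorS5Conjecture.lean`, port of
`TowerGraftLine.towerB_of_graftLaw`); the item closes by the one-line landing `theorem
towerBOfGraftLaw_holds : Theses.TowerDoorS5.TowerBOfGraftLaw := fun h =>
Theorems.TowerDoorS5.towerB_of_towerGraftLaw h` (any prover; filed so the ledger records the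
iteration joint by name — it is not a binder of `closes`). [difficulty: provable-now] -/
@[route_item "route-ValiantsHypothesis-TowerDoorS5"]
def TowerBOfGraftLaw : Prop :=
  TowerGraftLaw → ∃ C : ℕ, ∀ (m K : ℕ) (d : Fin K → ℕ), (∀ l l' : Fin K, l < l' → m * d l < d l') → Summit.ValiantsHypothesis.ValiantsHypothesis.Theorems.LacunarySymmetroidMatrixDescartes.PosRootLawOn m K (2 ^ (C * (K + Nat.log 2 m ^ 2))) d

/-- item stmt-ValiantsHypothesis-23805 · assembly · rank 1 · open · by planner
sources: tree:Summit.ValiantsHypothesis.ValiantsHypothesis.Theorems.LacunarySymmetroid.TowerDoor.valiant_of_towerB_alone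
[assembly] TowerGraftLaw → VP ≠ VNP. -/
@[route_item "route-ValiantsHypothesis-TowerDoorS5"]
def Assembly : Prop :=
  TowerGraftLaw → _root_.ValiantsHypothesis

/-! D-0027 §2.1 — DECIDING THEOREM (planner-authored via `route open/edit --closes-file`; by planner-tenure-valiant-dormant-sweep-g14-0 2026-08-28T23:22:34Z):
its hypotheses are this route's items and its conclusion the sub-problem Statement (glue_lint), and it elaborates with this file. -/

@[closes "route-ValiantsHypothesis-TowerDoorS5"] theorem closes (h : TowerGraftLaw) : _root_.ValiantsHypothesis :=
  Summit.ValiantsHypothesis.ValiantsHypothesis.Theorems.TowerDoorS5.valiant_of_towerGraftLaw h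

end Summit.ValiantsHypothesis.ValiantsHypothesis.Theses.TowerDoorS5
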